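import Mathlib
import HarnessLib
import Summits.HubbardSuperconductivity.HubbardSuperconductivity.Theorems.KLProgrammeKLRegimeTwoVolumeSubstitutionGluing
import Summits.HubbardSuperconductivity.HubbardSuperconductivity.Theorems.KLProgrammeKLRegimeTwoVolumeSubstitutionGluingBound
import Summits.HubbardSuperconductivity.HubbardSuperconductivity.Theorems.KLProgrammeKLRegimeTwoVolumeSubstitutionGluingWinding
import Summits.HubbardSuperconductivity.HubbardSuperconductivity.Theorems.KLProgrammeKLRegimeTwoVolumeSubstitutionPushforward

/-!
# Route `KLProgramme` — crux K3, the nested two-volume pass: THE SUBSTITUTION–GLUING BRACKET AT A DEEP PIN (bracket (iv) of VL-STUB-ROUTE-A-g8.md §3,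
# plan (R51); cell gate-hubbard-kl, seat hubbard-kl-k3c4-p1 g8; `--supports` stmt-…-20440)

Assembly of `…TwoVolumeSubstitutionGluing.norm_kernel_map_glue_sub_glue_map_le` (pointwise: other-block lifts + cross-block out-strings + winding lifts,
p547014) with the summed bounds `…SubstitutionGluingBound.sum_pinned_otherBlock_le / sum_pinned_crossBlock_le` (p548253) and
`…SubstitutionGluingWinding.sum_pinned_winding_le`: for a linear substitution `map (toLin' T′)` of the fine torus and `map (toLin' T)` of the coarse one
related by the periodisation `(P_T)`, block structures `e₁, e₂`, an element `V` of the coarse algebra with pinned profile `N` and far profile `Nfar` in degree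
`n+1`, and a DEEP out-pin `w′` (block `β₀`) — deep meaning: the pin's row outside its box and beyond the near region are tails `≤ τ`, the columns of deep
in-labels outside the box and their winding columns are tails `≤ τ`, near and zone in-labels are `Far` —

**`sum_norm_kernel_map_glue_sub_glue_map_le`**:
`Σ_{X′ : X′_p = w′} ‖kernel (map T′ (Glue V)) (n+1) X′ − kernel (Glue (map T V)) (n+1) X′‖ ≤ 2·aⁿ·τ·N + n·aⁿ·(5·τ·N + 2·a·Nfar)`.

All hypotheses are ONE-volume facts about `T′` (row/column sums `a`, tails `τ`, translation covariance in the box-collapsed column sums) and about `V`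
(profiles); the model discharges `(P_T)` and translation covariance by `…TwoVolumeSectorOverlapPeriodisation` (p545360), the near/zone/far geometry by
`…TwoVolumeDeepPinGeometry`.  §2 **`sum_norm_kernel_map_sub_glue_map_le_of_defect`** — THE TRANSFER OF THE TWO-VOLUME DEFECT THROUGH A SUBSTITUTION: for a fine
element `𝒲′` whose defect `𝒲′ − Glue 𝒲` against the glued coarse `𝒲` is small (`≤ E`) at near in-labels and bounded (`≤ ND`) everywhere,
`Σ_{X′ : X′_p = w′} ‖kernel (map T′ 𝒲′) X′ − kernel (Glue (map T 𝒲)) X′‖ ≤ aⁿ(a·E + τ·ND) + [2aⁿτN + n·aⁿ(5τN + 2a·Nfar)]` (pushforward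
`…SubstitutionPushforward` + §1) — the induction hypothesis of the inductive two-volume comparison carried to the next scale's field representation.
Everything is proved; no definition.
-/

noncomputable section

namespace Summit.HubbardSuperconductivity.HubbardSuperconductivity.Theorems.TwoVolumeDefect

set_option linter.dupNamespace false -- summit = problem name (single-conjunct summit), D-0017

open Finset Literature.MathematicalPhysics.QuantumLattice GrassmannAlgebra

variable {𝕜 : Type*} [RCLike 𝕜] {ι Γ₁ Γ₂ Γ₁' Γ₂' : Type*} [Fintype ι] [DecidableEq ι]
  [Fintype Γ₁] [DecidableEq Γ₁] [Fintype Γ₂] [DecidableEq Γ₂] [Fintype Γ₁'] [DecidableEq Γ₁'] [Fintype Γ₂'] [DecidableEq Γ₂']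

/-- **THE SUBSTITUTION–GLUING BRACKET AT A DEEP PIN.**  See the module docstring; `B(x′, β, y) := ‖T′ x′ (e₁⁻¹(β, y))‖`, `β₀ := (e₂ w′).1`. [folklore] -/
theorem sum_norm_kernel_map_glue_sub_glue_map_le (e₁ : Γ₁' ≃ ι × Γ₁) (e₂ : Γ₂' ≃ ι × Γ₂)
    (T : Matrix Γ₂ Γ₁ 𝕜) (T' : Matrix Γ₂' Γ₁' 𝕜)
    (hP : ∀ (X' : Γ₂') (Y : Γ₁), ∑ Y' ∈ univ.filter (fun Y' : Γ₁' => (e₁ Y').2 = Y), T' X' Y' = T (e₂ X').2 Y)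
    (Fe₁ : ι → (Γ₁ → 𝕜) →ₗ[𝕜] (Γ₁' → 𝕜)) (hFe₁ : ∀ β v X', Fe₁ β v X' = if (e₁ X').1 = β then v (e₁ X').2 else 0)
    (Fe₂ : ι → (Γ₂ → 𝕜) →ₗ[𝕜] (Γ₂' → 𝕜)) (hFe₂ : ∀ β v X', Fe₂ β v X' = if (e₂ X').1 = β then v (e₂ X').2 else 0)
    (V : GrassmannAlgebra 𝕜 Γ₁) {n : ℕ} (p : Fin (n + 1)) (w' : Γ₂')
    (Z Near : Γ₁ → Prop) [DecidablePred Z] [DecidablePred Near] (Far : Γ₁ → Γ₁ → Prop) [DecidableRel Far]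
    (hZ : ∀ y y', Near y → Z y' → Far y y')
    {a τ N Nfar : ℝ} (ha : 0 ≤ a) (hτ0 : 0 ≤ τ) (hN0 : 0 ≤ N) (hNfar0 : 0 ≤ Nfar)
    -- one-volume data of the fine substitution: column sums, box-collapsed column sums, the pin's row in its box
    (hcol : ∀ β y, ∑ x, ‖T' x (e₁.symm (β, y))‖ ≤ a)
    (hwin : ∀ β' y, ∑ β, ∑ x ∈ univ.filter (fun x : Γ₂' => (e₂ x).1 = β'), ‖T' x (e₁.symm (β, y))‖ ≤ a)
    (hρ : ∑ y, ‖T' w' (e₁.symm ((e₂ w').1, y))‖ ≤ a)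
    -- tails at the deep pin
    (hτ₁ : ∀ y, ¬ Z y → ∑ x ∈ univ.filter (fun x : Γ₂' => (e₂ x).1 ≠ (e₂ w').1), ‖T' x (e₁.symm ((e₂ w').1, y))‖ ≤ τ)
    (hτ₂ : ∑ β ∈ univ.erase (e₂ w').1, ∑ y, ‖T' w' (e₁.symm (β, y))‖ ≤ τ)
    (hτ₃ : ∑ y ∈ univ.filter (fun y : Γ₁ => ¬ Near y), ‖T' w' (e₁.symm ((e₂ w').1, y))‖ ≤ τ)
    (hτ₄ : ∀ y, ¬ Z y → ∑ β ∈ univ.erase (e₂ w').1, ∑ x ∈ univ.filter (fun x : Γ₂' => (e₂ x).1 = (e₂ w').1),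
      ‖T' x (e₁.symm (β, y))‖ ≤ τ)
    -- profiles of `V` in degree `n+1`, pinned at leg `p`
    (hN : ∀ y, ∑ Y ∈ univ.filter (fun Y : Fin (n + 1) → Γ₁ => Y p = y), ‖kernel 𝕜 V (n + 1) Y‖ ≤ N)
    (hNfar : ∀ y (i : Fin (n + 1)), ∑ Y ∈ univ.filter (fun Y : Fin (n + 1) → Γ₁ => Y p = y ∧ Far (Y p) (Y i)), ‖kernel 𝕜 V (n + 1) Y‖ ≤ Nfar) :
    ∑ X' ∈ univ.filter (fun X' : Fin (n + 1) → Γ₂' => X' p = w'),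
        ‖kernel 𝕜 (ExteriorAlgebra.map (Matrix.toLin' T') (∑ β, ExteriorAlgebra.map (Fe₁ β) V)) (n + 1) X' -
          kernel 𝕜 (∑ β, ExteriorAlgebra.map (Fe₂ β) (ExteriorAlgebra.map (Matrix.toLin' T) V)) (n + 1) X'‖ ≤
      2 * a ^ n * τ * N + n * a ^ n * (5 * τ * N + 2 * a * Nfar) := by
  classical
  set β₀ : ι := (e₂ w').1 with hβ₀
  set B : Γ₂' → ι → Γ₁ → ℝ := fun x β y => ‖T' x (e₁.symm (β, y))‖ with hBdef
  set k : (Fin (n + 1) → Γ₁) → ℝ := fun Y => ‖kernel 𝕜 V (n + 1) Y‖ with hkdef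
  have hB : ∀ x β y, 0 ≤ B x β y := fun _ _ _ => norm_nonneg _
  have hk : ∀ Y, 0 ≤ k Y := fun _ => norm_nonneg _
  have hw : (fun x : Γ₂' => (e₂ x).1) w' = β₀ := rfl
  -- the pointwise three-term bound, with `β₀` in place of the block of `X′ p`
  have hpt : ∀ X' ∈ univ.filter (fun X' : Fin (n + 1) → Γ₂' => X' p = w'),
      ‖kernel 𝕜 (ExteriorAlgebra.map (Matrix.toLin' T') (∑ β, ExteriorAlgebra.map (Fe₁ β) V)) (n + 1) X' -
          kernel 𝕜 (∑ β, ExteriorAlgebra.map (Fe₂ β) (ExteriorAlgebra.map (Matrix.toLin' T) V)) (n + 1) X'‖ ≤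
        (∑ Y : Fin (n + 1) → Γ₁, k Y * ∑ β ∈ univ.erase β₀, ∏ i, B (X' i) β (Y i)) +
          (∑ Y : Fin (n + 1) → Γ₁, k Y * (if ∀ i, (fun x : Γ₂' => (e₂ x).1) (X' i) = β₀ then 0 else ∏ i, B (X' i) β₀ (Y i))) +
          (∑ Y : Fin (n + 1) → Γ₁, k Y * (if ∀ i, (fun x : Γ₂' => (e₂ x).1) (X' i) = β₀ then
            ∑ βs ∈ univ.erase (fun _ : Fin (n + 1) => β₀), ∏ i, B (X' i) (βs i) (Y i) else 0)) := by
    intro X' hX'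
    have hXp : (e₂ (X' p)).1 = β₀ := by rw [(mem_filter.1 hX').2]
    have h := norm_kernel_map_glue_sub_glue_map_le e₁ e₂ T T' hP Fe₁ hFe₁ Fe₂ hFe₂ V p X'
    rw [hXp] at h
    refine h.trans (le_of_eq ?_)
    rw [← sum_add_distrib, ← sum_add_distrib]
    exact sum_congr rfl fun Y _ => by ring
  refine (sum_le_sum hpt).trans ?_
  rw [sum_add_distrib, sum_add_distrib]
  have h2 := sum_pinned_otherBlock_le B hB k hk p w' β₀ ha hN0 hcol hτ₂ hN
  have h1 := sum_pinned_crossBlock_le B hB k hk p w' (fun x : Γ₂' => (e₂ x).1) β₀ hw Z Near Far hZ ha hτ0 hN0 hNfar0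
    hcol hρ hτ₁ hτ₃ hN hNfar
  have h3 := sum_pinned_winding_le B hB k hk p w' (fun x : Γ₂' => (e₂ x).1) β₀ hw Z Near Far hZ ha hτ0 hN0 hNfar0
    hwin hρ hτ₂ hτ₃ hτ₄ hN hNfar
  refine (add_le_add (add_le_add h2 h1) h3).trans (le_of_eq ?_)
  ring

/-- Kernels of a difference (local copy of `GrassmannDefectSplit.kernel_sub'`). [folklore] -/
theorem kernel_sub_eq {Γ : Type*} [Fintype Γ] [DecidableEq Γ] (A B : GrassmannAlgebra 𝕜 Γ) (m : ℕ) (X : Fin m → Γ) :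
    kernel 𝕜 (A - B) m X = kernel 𝕜 A m X - kernel 𝕜 B m X := by
  rw [sub_eq_add_neg, kernel_add, ← neg_one_smul 𝕜 B, kernel_smul, neg_one_mul, ← sub_eq_add_neg]

/-- **THE TRANSFER OF THE TWO-VOLUME DEFECT THROUGH A SUBSTITUTION.**  Fine element `𝒲′`, coarse element `𝒲` (profiles `N`, `Nfar`), defect `𝒲′ − Glue 𝒲` with
pinned profile `≤ E` at the in-labels `NearF` of the pin and `≤ ND` everywhere; substitution data as in `sum_norm_kernel_map_glue_sub_glue_map_le` plus the pin's
row split at `NearF` (`≤ a` near, `≤ τ` beyond):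
`Σ_{X′ : X′_p = w′} ‖kernel (map T′ 𝒲′) (n+1) X′ − kernel (Glue (map T 𝒲)) (n+1) X′‖ ≤ aⁿ·(a·E + τ·ND) + (2·aⁿ·τ·N + n·aⁿ·(5·τ·N + 2·a·Nfar))`. [folklore] -/
theorem sum_norm_kernel_map_sub_glue_map_le_of_defect (e₁ : Γ₁' ≃ ι × Γ₁) (e₂ : Γ₂' ≃ ι × Γ₂)
    (T : Matrix Γ₂ Γ₁ 𝕜) (T' : Matrix Γ₂' Γ₁' 𝕜)
    (hP : ∀ (X' : Γ₂') (Y : Γ₁), ∑ Y' ∈ univ.filter (fun Y' : Γ₁' => (e₁ Y').2 = Y), T' X' Y' = T (e₂ X').2 Y)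
    (Fe₁ : ι → (Γ₁ → 𝕜) →ₗ[𝕜] (Γ₁' → 𝕜)) (hFe₁ : ∀ β v X', Fe₁ β v X' = if (e₁ X').1 = β then v (e₁ X').2 else 0)
    (Fe₂ : ι → (Γ₂ → 𝕜) →ₗ[𝕜] (Γ₂' → 𝕜)) (hFe₂ : ∀ β v X', Fe₂ β v X' = if (e₂ X').1 = β then v (e₂ X').2 else 0)
    (W' : GrassmannAlgebra 𝕜 Γ₁') (W : GrassmannAlgebra 𝕜 Γ₁) {n : ℕ} (p : Fin (n + 1)) (w' : Γ₂')
    (Z Near : Γ₁ → Prop) [DecidablePred Z] [DecidablePred Near] (Far : Γ₁ → Γ₁ → Prop) [DecidableRel Far]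
    (hZ : ∀ y y', Near y → Z y' → Far y y') (NearF : Γ₁' → Prop) [DecidablePred NearF]
    {a τ N Nfar E ND : ℝ} (ha : 0 ≤ a) (hτ0 : 0 ≤ τ) (hN0 : 0 ≤ N) (hNfar0 : 0 ≤ Nfar) (hE0 : 0 ≤ E) (hND0 : 0 ≤ ND)
    (hcol : ∀ y', ∑ x, ‖T' x y'‖ ≤ a)
    (hwin : ∀ β' y, ∑ β, ∑ x ∈ univ.filter (fun x : Γ₂' => (e₂ x).1 = β'), ‖T' x (e₁.symm (β, y))‖ ≤ a)
    (hρ : ∑ y, ‖T' w' (e₁.symm ((e₂ w').1, y))‖ ≤ a)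
    (hrowF : ∑ y' ∈ univ.filter (fun y' : Γ₁' => NearF y'), ‖T' w' y'‖ ≤ a)
    (hτF : ∑ y' ∈ univ.filter (fun y' : Γ₁' => ¬ NearF y'), ‖T' w' y'‖ ≤ τ)
    (hτ₁ : ∀ y, ¬ Z y → ∑ x ∈ univ.filter (fun x : Γ₂' => (e₂ x).1 ≠ (e₂ w').1), ‖T' x (e₁.symm ((e₂ w').1, y))‖ ≤ τ)
    (hτ₂ : ∑ β ∈ univ.erase (e₂ w').1, ∑ y, ‖T' w' (e₁.symm (β, y))‖ ≤ τ)
    (hτ₃ : ∑ y ∈ univ.filter (fun y : Γ₁ => ¬ Near y), ‖T' w' (e₁.symm ((e₂ w').1, y))‖ ≤ τ)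
    (hτ₄ : ∀ y, ¬ Z y → ∑ β ∈ univ.erase (e₂ w').1, ∑ x ∈ univ.filter (fun x : Γ₂' => (e₂ x).1 = (e₂ w').1),
      ‖T' x (e₁.symm (β, y))‖ ≤ τ)
    (hN : ∀ y, ∑ Y ∈ univ.filter (fun Y : Fin (n + 1) → Γ₁ => Y p = y), ‖kernel 𝕜 W (n + 1) Y‖ ≤ N)
    (hNfar : ∀ y (i : Fin (n + 1)), ∑ Y ∈ univ.filter (fun Y : Fin (n + 1) → Γ₁ => Y p = y ∧ Far (Y p) (Y i)), ‖kernel 𝕜 W (n + 1) Y‖ ≤ Nfar)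
    (hE : ∀ y', NearF y' → ∑ Y' ∈ univ.filter (fun Y' : Fin (n + 1) → Γ₁' => Y' p = y'),
      ‖kernel 𝕜 (W' - ∑ β, ExteriorAlgebra.map (Fe₁ β) W) (n + 1) Y'‖ ≤ E)
    (hND : ∀ y', ∑ Y' ∈ univ.filter (fun Y' : Fin (n + 1) → Γ₁' => Y' p = y'),
      ‖kernel 𝕜 (W' - ∑ β, ExteriorAlgebra.map (Fe₁ β) W) (n + 1) Y'‖ ≤ ND) :
    ∑ X' ∈ univ.filter (fun X' : Fin (n + 1) → Γ₂' => X' p = w'),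
        ‖kernel 𝕜 (ExteriorAlgebra.map (Matrix.toLin' T') W') (n + 1) X' -
          kernel 𝕜 (∑ β, ExteriorAlgebra.map (Fe₂ β) (ExteriorAlgebra.map (Matrix.toLin' T) W)) (n + 1) X'‖ ≤
      a ^ n * (a * E + τ * ND) + (2 * a ^ n * τ * N + n * a ^ n * (5 * τ * N + 2 * a * Nfar)) := by
  classical
  -- split `map T′ W′ = map T′ (W′ − Glue W) + map T′ (Glue W)`
  have hsplit : ∀ X' : Fin (n + 1) → Γ₂',
      kernel 𝕜 (ExteriorAlgebra.map (Matrix.toLin' T') W') (n + 1) X' -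
          kernel 𝕜 (∑ β, ExteriorAlgebra.map (Fe₂ β) (ExteriorAlgebra.map (Matrix.toLin' T) W)) (n + 1) X' =
        kernel 𝕜 (ExteriorAlgebra.map (Matrix.toLin' T') (W' - ∑ β, ExteriorAlgebra.map (Fe₁ β) W)) (n + 1) X' +
          (kernel 𝕜 (ExteriorAlgebra.map (Matrix.toLin' T') (∑ β, ExteriorAlgebra.map (Fe₁ β) W)) (n + 1) X' -
            kernel 𝕜 (∑ β, ExteriorAlgebra.map (Fe₂ β) (ExteriorAlgebra.map (Matrix.toLin' T) W)) (n + 1) X') := by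
    intro X'
    rw [map_sub, kernel_sub_eq]
    ring
  have hcol' : ∀ (β : ι) (y : Γ₁), ∑ x, ‖T' x (e₁.symm (β, y))‖ ≤ a := fun β y => hcol _
  have h1 := sum_pinned_norm_kernel_map_le_of_near T' (W' - ∑ β, ExteriorAlgebra.map (Fe₁ β) W) p w' NearF ha hE0 hND0 hcol hrowF hτF hE hND
  have h2 := sum_norm_kernel_map_glue_sub_glue_map_le e₁ e₂ T T' hP Fe₁ hFe₁ Fe₂ hFe₂ W p w' Z Near Far hZ ha hτ0 hN0 hNfar0 hcol' hwin hρ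
    hτ₁ hτ₂ hτ₃ hτ₄ hN hNfar
  calc ∑ X' ∈ univ.filter (fun X' : Fin (n + 1) → Γ₂' => X' p = w'),
          ‖kernel 𝕜 (ExteriorAlgebra.map (Matrix.toLin' T') W') (n + 1) X' -
            kernel 𝕜 (∑ β, ExteriorAlgebra.map (Fe₂ β) (ExteriorAlgebra.map (Matrix.toLin' T) W)) (n + 1) X'‖
      ≤ ∑ X' ∈ univ.filter (fun X' : Fin (n + 1) → Γ₂' => X' p = w'),
          (‖kernel 𝕜 (ExteriorAlgebra.map (Matrix.toLin' T') (W' - ∑ β, ExteriorAlgebra.map (Fe₁ β) W)) (n + 1) X'‖ +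
            ‖kernel 𝕜 (ExteriorAlgebra.map (Matrix.toLin' T') (∑ β, ExteriorAlgebra.map (Fe₁ β) W)) (n + 1) X' -
              kernel 𝕜 (∑ β, ExteriorAlgebra.map (Fe₂ β) (ExteriorAlgebra.map (Matrix.toLin' T) W)) (n + 1) X'‖) :=
        sum_le_sum fun X' _ => by rw [hsplit X']; exact norm_add_le _ _
    _ ≤ _ := by rw [sum_add_distrib]; exact add_le_add h1 h2

end Summit.HubbardSuperconductivity.HubbardSuperconductivity.Theorems.TwoVolumeDefect

end
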